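import Summits.HodgeConjecture.HodgeConjecture.Theorems.F0P3U3PrincipalSeriesJacquetClosedCell  -- ★ A-p19: GENERIC §1 `evalJacquetKer` (closed cell: `finrank (r ⧸ ℓ) ≤ dim W`)
import Literature.NumberTheory.Automorphic.SmoothIndOpenCellCoinvariants                       -- ★ A-p19: GENERIC (U) `finrank_le_of_forall_mem_iff_exists_toFun_one_eq_zero_normalizedInd`
import Literature.NumberTheory.Automorphic.U3PrincipalSeriesCellFunCompactSupport              -- ★ A-p13: GENERIC-`N` (Supp) `hasCompactSupport_cellFun_cmBorel`
import Literature.NumberTheory.Automorphic.U2LocalBruhatDecomposition                          -- ★ F0P2-p06 (g7): `u2LocalBruhatDecomposition` (`U(Φ₂) = B ⊔ B w₀ N`)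
import Literature.NumberTheory.Automorphic.JacquetNonzeroEmbedsNormalizedInd                   -- ★ `deltaChar_cmBorelTriple_eq_one_of_mem_N` (every `N`)
import Literature.NumberTheory.Automorphic.UnitaryGroupUnipotentLimitCompactOpen               -- ★ `isLimitOfCompactOpen_cmBorelTriple_N` (every `N`)
import HarnessLib

/-!
# `dim r_B i(χ) ≤ 2` for the principal series of `U(Φ₂)(L⁺_v) ≅ U(1,1)` at a non-split place (pole H1′ of the (N-H-ii) road)

Cell hodgecm-mathlib (FLOOR 0), crux `H413` = `stmt-HodgeConjecture-24833`, line «CMCharIdentityTest»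
(`Cruxes/H413/Lines/F0_P3b_CMCharIdentityTestPaydown.lean`, ED. 11), open joint (N-H-ii′) `stub_hPrincipalSeriesJH` ⟸ (JH₂) (★-pending
`F0P3bHPrincipalSeriesJHOfUTwo.hPrincipalSeriesJH_of_uTwo`), whose LENGTH conjunct («no chain `⊥ < N₁ < N₂ < ⊤` in `i(χH₂)`») is fed to ★
`Representation.not_bot_lt_lt_lt_top_of_finrank_coinvariants_le_two` — which needs ONLY the upper bound `finrank r_B i(χ) ≤ 2` (+ finite
dimensionality), not the full Jacquet filtration.  THIS FILE proves that bound for `G = U(Φ₂)(L⁺_v)`, `v` NON-SPLIT, EVERY character `χ` of the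
diagonal torus (theorems only; no `def`, no named fact, no `sorry`):

* §1 (Supp)₂ `hasCompactSupport_cellFun_cmBorel_two` — the cell functions `n ↦ f(w₀ n)` of the `f ∈ Ind_B^G τ` with `f(1) = 0` have compact
  support (★ GENERIC-`N` `hasCompactSupport_cellFun_cmBorel` over ★ `u2LocalBruhatDecomposition`; the `N = 2` twin of ★ `…_cmBorel_three`);
* §2 **`finiteDimensional_finrank_coinvariants_cmPrincipalSeries_two_le_two`** — `r_B i(χ)` is finite-dimensional of dimension `≤ 2`:
  `ℓ := ker (ev₁ : r_B i(χ) → ℂ_χ)` (★ GENERIC `evalJacquetKer`, closed cell, `finrank (r ⧸ ℓ) ≤ 1`; `hδ` = ★ `deltaChar_cmBorelTriple_eq_one_of_mem_N`)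
  and `finrank ℓ ≤ 1` (★ GENERIC open-cell bound over `U(Φ₂) = B ⊔ B w₀ N`, §1, ★ `isLimitOfCompactOpen_cmBorelTriple_N`); rank–nullity.
The `wχ`-action on `ℓ` and the lower bounds (`ℓ ≠ 0`, `r ⧸ ℓ ≠ 0`) of the `N = 3` node N1 are NOT needed by the consumer and are not proved here.
HONEST LABEL: HC_CM is proved only modulo the 2 remaining named inputs (hLiu418, h413) until rung 0 closes; this file pays no letter by itself.

## References
* [Casselman1995] W. Casselman, *Introduction to the theory of admissible representations of p-adic reductive groups* (1995), Lemma 7.1.1 (a)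
  p. 67, §6.3 (Bruhat filtration of `Ind|_P`), Prop. 6.3.1, Prop. 1.3.1.
* [BernsteinZelevinsky1977] I. N. Bernstein, A. V. Zelevinsky, Ann. Sci. ÉNS 10 (1977), §2.12 Geometrical Lemma, Cor. 2.13 (c); Thm. 5.2.
* [Rogawski1990] J. D. Rogawski, *Automorphic Representations of Unitary Groups in Three Variables* (1990), §12.1 p. 171 (`U(1,1) × U(1)`).
-/

set_option autoImplicit false
set_option linter.dupNamespace false

noncomputable section

open NumberField IsDedekindDomain
open Literature.NumberTheory.Automorphic Literature.NumberTheory.Automorphic.UnitaryGroup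
open scoped MatrixGroups

namespace Summit.HodgeConjecture.HodgeConjecture.Cruxes.H413.F0P3bU2PrincipalSeriesJacquetRankLeTwo

open Summit.HodgeConjecture.HodgeConjecture.Cruxes.H413.F0P3U3PrincipalSeriesJacquetClosedCell

variable (L : Type) [Field L] [NumberField L] [IsCMField L]

/-! ## §1 (Supp)₂ — compact support of the cell functions for `U(Φ₂)` at a non-split place -/

set_option maxHeartbeats 1600000 in  -- as ★ `hasCompactSupport_cellFun_cmBorel_three` (instance paths on the CM carrier)
/-- **COMPACT SUPPORT OF THE CELL FUNCTION ON `N(L⁺_v)` FOR `U(Φ₂)` AT A NON-SPLIT PLACE** — the `N = 2` twin of ★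
`hasCompactSupport_cellFun_cmBorel_three`: `w₀ ∈ U(Φ₂)(L⁺_v)` the element with matrix `Φ₂` (★ `u2LocalBruhatDecomposition`: `G = B ⊔ B w₀ N`,
unique coordinates); for every representation `τ` of `B` and every `f ∈ Ind_B^G τ` with `f(1) = 0`, `n ↦ f (w₀ n)` has compact support on
`N(L⁺_v)` (★ GENERIC `hasCompactSupport_cellFun_cmBorel`, open mapping theorem). [cite: Casselman1995, Prop. 1.3.1, Prop. 1.3.3, Prop. 6.3.1] -/
theorem hasCompactSupport_cellFun_cmBorel_two (v : HeightOneSpectrum (𝓞 ↥(maximalRealSubfield L)))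
    (hv : ∀ w : PlacesOver L v, IsCMField.complexConj L • w.1 = w.1)
    (w₀ : ↥(unitaryGroupOfForm (conjLocal L (IsCMField.complexConj L) v) (cmLocalForm L 2 v)))
    (hw₀ : Units.val (w₀ : GL (Fin 2) (LocalRing L v)) = cmLocalForm L 2 v)
    {k : Type*} [CommRing k] {W : Type*} [AddCommGroup W] [Module k W]
    (τ : Representation k ↥(cmBorelTriple L 2 v).P W)
    (f : Representation.SmoothInd (cmBorelTriple L 2 v).P τ) (hf : f.toFun 1 = 0) :
    HasCompactSupport fun n : ↥(cmBorelTriple L 2 v).N => f.toFun (w₀ * n) := by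
  obtain ⟨w₀', hw₀', hnot, hcells, huniq⟩ := u2LocalBruhatDecomposition L v hv
  have hww : w₀' = w₀ := Subtype.ext (Units.ext (hw₀'.trans hw₀.symm))
  subst hww
  refine hasCompactSupport_cellFun_cmBorel L 2 v w₀' (fun g hg => ?_) (fun b hb n hmem => ?_) (fun b hb n n' h => ?_) τ f hf
  · -- the big cell
    rcases hcells g with hgB | ⟨b, hb, n, hn, hg'⟩
    · exact absurd hgB hg
    · exact ⟨b, hb, ⟨n, hn⟩, hg'⟩
  · -- the two cells are disjoint: `b w₀ n ∈ B` would put `w₀ = b⁻¹ (b w₀ n) n⁻¹` in `B`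
    apply hnot
    have hnB : (n : ↥(unitaryGroupOfForm (conjLocal L (IsCMField.complexConj L) v) (cmLocalForm L 2 v))) ∈
        (cmBorelTriple L 2 v).P := (cmBorelTriple L 2 v).N_le n.2
    have : w₀' = b⁻¹ * (b * w₀' * n) * (n : ↥(unitaryGroupOfForm (conjLocal L (IsCMField.complexConj L) v) (cmLocalForm L 2 v)))⁻¹ := by
      group
    rw [this]
    exact Subgroup.mul_mem _ (Subgroup.mul_mem _ (Subgroup.inv_mem _ hb) hmem) (Subgroup.inv_mem _ hnB)
  · -- uniqueness of the `N`-coordinate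
    have hb' : b ∈ borelU (conjLocal L (IsCMField.complexConj L) v) (cmLocalForm L 2 v) := hb
    have hn : (n : ↥(unitaryGroupOfForm (conjLocal L (IsCMField.complexConj L) v) (cmLocalForm L 2 v))) ∈
        unipotentU (conjLocal L (IsCMField.complexConj L) v) (cmLocalForm L 2 v) := n.2
    have hn' : (n' : ↥(unitaryGroupOfForm (conjLocal L (IsCMField.complexConj L) v) (cmLocalForm L 2 v))) ∈
        unipotentU (conjLocal L (IsCMField.complexConj L) v) (cmLocalForm L 2 v) := n'.2
    have h1 : b * w₀' * (n : ↥(unitaryGroupOfForm (conjLocal L (IsCMField.complexConj L) v) (cmLocalForm L 2 v))) =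
        1 * w₀' * (n' : ↥(unitaryGroupOfForm (conjLocal L (IsCMField.complexConj L) v) (cmLocalForm L 2 v))) := by
      rw [one_mul]; exact h
    have h2 := huniq b hb' 1 (Subgroup.one_mem _)
      (n : ↥(unitaryGroupOfForm (conjLocal L (IsCMField.complexConj L) v) (cmLocalForm L 2 v))) hn
      (n' : ↥(unitaryGroupOfForm (conjLocal L (IsCMField.complexConj L) v) (cmLocalForm L 2 v))) hn' h1
    exact Subtype.ext h2.2

/-! ## §2 `r_B i(χ)` is finite-dimensional of dimension `≤ 2` -/

set_option synthInstance.maxHeartbeats 400000 in  -- instance paths on the CM carrier `∏_{w ∣ v} L_w` (as ★ `finrank_le_one_of_hasCompactSupport_cellFun`)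
set_option maxHeartbeats 2000000 in  -- the `rfl`-bridge `cmPrincipalSeries L 2 v χ = normalizedInd (cmBorelTriple L 2 v) (𝟙 ⊗ χ)` (cf. ★ `finrank_le_one_cmPrincipalSeries`)
/-- **`r_B i_G(χ)` IS FINITE-DIMENSIONAL OF DIMENSION `≤ 2` for `G = U(Φ₂)(L⁺_v)` at a NON-SPLIT place, every character `χ` of `T(L⁺_v)`**
(the upper-bound half of Casselman's Lemma 7.1.1 (a) ∕ the Geometrical Lemma for the rank-one group `U(1,1)`, `|W| = 2`): with
`ℓ := ker (ev₁ : r_B i(χ) → ℂ_χ)` (★ `evalJacquetKer`; closed cell: `r ⧸ ℓ ↪ ℂ`, `finrank (r ⧸ ℓ) ≤ 1`) and the open-cell bound `finrank ℓ ≤ 1`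
(★ `finrank_le_of_forall_mem_iff_exists_toFun_one_eq_zero_normalizedInd` over `U(Φ₂) = B ⊔ B w₀ N` ★ `u2LocalBruhatDecomposition`, (Supp)₂ §1,
★ `isLimitOfCompactOpen_cmBorelTriple_N`), `r` is an extension of `r ⧸ ℓ` by `ℓ`: rank–nullity.
[cite: Casselman1995, Lemma 7.1.1 (a) p. 67; §6.3] [cite: BernsteinZelevinsky1977, §2.12 Geometrical Lemma, Cor. 2.13 (c)] [cite: Rogawski1990, §12.1 p. 171] -/
theorem finiteDimensional_finrank_coinvariants_cmPrincipalSeries_two_le_two (v : HeightOneSpectrum (𝓞 ↥(maximalRealSubfield L)))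
    (hns : ∀ w : PlacesOver L v, IsCMField.complexConj L • w.1 = w.1)
    (χ : ↥(torusU (conjLocal L (IsCMField.complexConj L) v) (cmLocalForm L 2 v)) →* ℂˣ) :
    haveI := locallyCompactSpace_cmBorelU L 2 v
    FiniteDimensional ℂ ((cmBorelTriple L 2 v).restrict (cmPrincipalSeries L 2 v χ)).Coinvariants ∧
      Module.finrank ℂ ((cmBorelTriple L 2 v).restrict (cmPrincipalSeries L 2 v χ)).Coinvariants ≤ 2 := by
  haveI := locallyCompactSpace_cmBorelU L 2 v
  -- Bruhat (stepwise: the one-shot `obtain` is slow at `isDefEq`, cf. ★ `finrank_le_one_of_hasCompactSupport_cellFun`)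
  have H0 := u2LocalBruhatDecomposition L v
  have H1 := H0 hns
  obtain ⟨w₀, hval, -, hBruhat, -⟩ := H1
  have hB : ∀ g : ↥(unitaryGroupOfForm (conjLocal L (IsCMField.complexConj L) v) (cmLocalForm L 2 v)),
      g ∈ (cmBorelTriple L 2 v).P ∨ ∃ p ∈ (cmBorelTriple L 2 v).P, ∃ n ∈ (cmBorelTriple L 2 v).N, g = p * w₀ * n := hBruhat
  -- (Supp)₂
  have hS : ∀ f : Representation.SmoothInd (cmBorelTriple L 2 v).P
      (Representation.twist
        ((((Representation.trivial ℂ ↥(torusU (conjLocal L (IsCMField.complexConj L) v) (cmLocalForm L 2 v)) ℂ).twist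
          χ)).comp (cmBorelTriple L 2 v).proj) (rootDeltaChar (cmBorelTriple L 2 v).P)),
      f.toFun 1 = 0 → HasCompactSupport fun n : ↥(cmBorelTriple L 2 v).N =>
        f.toFun (w₀ * (n : ↥(unitaryGroupOfForm (conjLocal L (IsCMField.complexConj L) v) (cmLocalForm L 2 v)))) :=
    fun f hf => hasCompactSupport_cellFun_cmBorel_two L v hns w₀ hval _ f hf
  have hN := isLimitOfCompactOpen_cmBorelTriple_N L 2 v
  -- the closed-cell kernel `ℓ`
  have hδ := deltaChar_cmBorelTriple_eq_one_of_mem_N L 2 v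
  have hℓ := mem_evalJacquetKer_iff (cmBorelTriple L 2 v)
    ((Representation.trivial ℂ ↥(torusU (conjLocal L (IsCMField.complexConj L) v) (cmLocalForm L 2 v)) ℂ).twist χ) hδ
  -- (U) `finrank ℓ ≤ 1`
  have HU := Representation.finrank_le_of_forall_mem_iff_exists_toFun_one_eq_zero_normalizedInd (cmBorelTriple L 2 v)
    ((Representation.trivial ℂ ↥(torusU (conjLocal L (IsCMField.complexConj L) v) (cmLocalForm L 2 v)) ℂ).twist χ) w₀
    hN hB hS _ hℓ
  obtain ⟨hfdℓ, hrkℓ⟩ := HU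
  -- (C) `finrank (r ⧸ ℓ) ≤ 1`
  have hfdq := finiteDimensional_quotient_evalJacquetKer (cmBorelTriple L 2 v)
    ((Representation.trivial ℂ ↥(torusU (conjLocal L (IsCMField.complexConj L) v) (cmLocalForm L 2 v)) ℂ).twist χ) hδ
  have hrkq := finrank_quotient_evalJacquetKer_le (cmBorelTriple L 2 v)
    ((Representation.trivial ℂ ↥(torusU (conjLocal L (IsCMField.complexConj L) v) (cmLocalForm L 2 v)) ℂ).twist χ) hδ
  haveI := hfdℓ
  haveI := hfdq
  -- rank–nullity for `0 → ℓ → r → r ⧸ ℓ → 0`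
  have hfd : FiniteDimensional ℂ ((cmBorelTriple L 2 v).restrict (Representation.normalizedInd (cmBorelTriple L 2 v)
      ((Representation.trivial ℂ ↥(torusU (conjLocal L (IsCMField.complexConj L) v) (cmLocalForm L 2 v)) ℂ).twist χ))).Coinvariants :=
    Module.Finite.of_exact (LinearMap.exact_subtype_mkQ _) (Submodule.mkQ_surjective
      (evalJacquetKer (cmBorelTriple L 2 v)
        ((Representation.trivial ℂ ↥(torusU (conjLocal L (IsCMField.complexConj L) v) (cmLocalForm L 2 v)) ℂ).twist χ) hδ))
  haveI := hfd
  have hsum := Submodule.finrank_quotient_add_finrank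
    (evalJacquetKer (cmBorelTriple L 2 v)
      ((Representation.trivial ℂ ↥(torusU (conjLocal L (IsCMField.complexConj L) v) (cmLocalForm L 2 v)) ℂ).twist χ) hδ)
  have h1 : Module.finrank ℂ ℂ = 1 := Module.finrank_self ℂ
  refine ⟨hfd, ?_⟩
  change Module.finrank ℂ ((cmBorelTriple L 2 v).restrict (Representation.normalizedInd (cmBorelTriple L 2 v)
      ((Representation.trivial ℂ ↥(torusU (conjLocal L (IsCMField.complexConj L) v) (cmLocalForm L 2 v)) ℂ).twist χ))).Coinvariants ≤ 2
  omega

end Summit.HodgeConjecture.HodgeConjecture.Cruxes.H413.F0P3bU2PrincipalSeriesJacquetRankLeTwo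

end
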